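import Mathlib.LinearAlgebra.Trace
import Mathlib.Algebra.Algebra.Basic
import HarnessLib

/-!
# Operator algebra of the type-III position: the centraliser of a weight-one `sl₂`-triple and its trace table

Family `hodge`, layer `Literature/AlgebraicGeometry/Motives` (namespace `ProjectorBlocks`, continuing
`HodgeLieWeightOneRankFourBlocks` / `HodgeLieWeightOneGrading`); THEOREMS ONLY (no definition, no named fact; D-0026).
Pure linear algebra over a field `K`, written for the cell `pub-hodgecm2` (COR-CM) lane MT-RANK-SEVEN-TYPEIII, seat `b27`:
the identities used by `HodgeLieWeightOnePlusLineIdeal` and its sequels for the triple `E`, `F`, `Θ = 2P − 1` of the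
type-III position (`P² = P`, `P E = E`, `E P = 0`, `P F = 0`, `F P = F`, `E F = αP`, `F E = α(1 − P)`, `α ≠ 0`; so
`W ≅ std ⊗ W₁` for `⟨E, F, Θ⟩ ≅ 𝔰𝔩₂`, Fulton–Harris §11.1) and an operator `K` commuting with it.

* `commute_projF_of_commute` — an operator commuting with `P` and `E` commutes with `F`.
* `eq_zero_of_combination_eq_zero` — `cE + c'F + dΘ + K = 0` with `K` commuting with `P`, `E` forces `c = c' = d = 0` and
  `K = 0` (`E, F ≠ 0`).
* TRACE TABLE: for `z` commuting with `P` (resp. `E`) and `K` commuting with `P` (resp. `E`):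
  `trace_mul_projE_mul_eq_zero` (`tr(zEK) = 0`), `trace_mul_projF_mul_eq_zero` (`tr(zFK) = 0`),
  `two_mul_trace_mul_proj_mul` (`2 tr(zPK) = tr(zK)`), `trace_mul_theta_mul_eq_zero` (`tr(zΘK) = 0`),
  `two_mul_trace_mul_proj` (`2 tr(zP) = tr z`, `tr(zEF) = α tr(zP)`).

## References

* [FultonHarris1991] W. Fulton, J. Harris, *Representation Theory*, GTM 129 (1991), Lecture 11 (§11.1).
* [MoonenZarhin1999LowDim] B. Moonen, Yu. Zarhin, *Hodge classes on abelian varieties of low dimension*, Math. Ann. 315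
  (1999), §2 (2.3) Type III.
-/

noncomputable section

namespace Literature.AlgebraicGeometry.Motives

/-! ## §1 Operator algebra of the type-III position -/

namespace ProjectorBlocks

variable {K : Type*} [Field K] {W : Type*} [AddCommGroup W] [Module K W]

/-- **An operator commuting with `P` and `E` commutes with `F`** when `E F = αP`, `F E = α(1 − P)`, `α ≠ 0`, `F P = F`,
`F² = 0`: with `Z = K F − F K` one has `Z E = 0` and `Z F = −F K F`, so `αZ = Z(EF + FE) = −F K F E = −αF K (1 − P) =
−αF (1 − P) K = 0`. [cite: FultonHarris1991, Lecture 11 (§11.1)] [cite: MoonenZarhin1999LowDim, §2 (2.3)] -/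
theorem commute_projF_of_commute {P E F Z : Module.End K W} {α : K} (hα : α ≠ 0) (hFP : F * P = F)
    (hFF : F * F = 0) (hEF : E * F = α • P) (hFE : F * E = α • (1 - P))
    (hZP : Z * P = P * Z) (hZE : Z * E = E * Z) : Z * F = F * Z := by
  have hsum : E * F + F * E = α • (1 : Module.End K W) := by rw [hEF, hFE, ← smul_add, add_sub_cancel]
  have hZQ : Z * (1 - P) = (1 - P) * Z := by rw [mul_sub, sub_mul, mul_one, one_mul, hZP]
  have h1 : (Z * F - F * Z) * E = 0 := by
    rw [sub_mul, mul_assoc, hFE, mul_assoc, hZE, ← mul_assoc F E Z, hFE, mul_smul_comm, smul_mul_assoc, hZQ, sub_self]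
  have h2 : (Z * F - F * Z) * F = -(F * Z * F) := by rw [sub_mul, mul_assoc, hFF, mul_zero, zero_sub, mul_assoc]
  have hFQ : F * (1 - P) = 0 := by rw [mul_sub, mul_one, hFP, sub_self]
  have h3 : α • (Z * F - F * Z) = 0 := by
    calc α • (Z * F - F * Z) = (Z * F - F * Z) * (E * F + F * E) := by rw [hsum, mul_smul_comm, mul_one]
      _ = (Z * F - F * Z) * E * F + (Z * F - F * Z) * F * E := by rw [mul_add, mul_assoc, mul_assoc]
      _ = 0 := by
        rw [h1, zero_mul, zero_add, h2, neg_mul, mul_assoc, hFE, mul_smul_comm, mul_assoc, hZQ, ← mul_assoc, hFQ,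
          zero_mul, smul_zero, neg_zero]
  exact sub_eq_zero.1 ((smul_eq_zero.1 h3).resolve_left hα)

/-- **Uniqueness of the decomposition `cE + c'F + dΘ + K`**: if `K` commutes with `P` and `E`, `E ≠ 0`, `F ≠ 0`, and
`cE + c'F + d(2P − 1) + K = 0`, then `c = c' = d = 0` and `K = 0` (take the three `P`-corners, then bracket with `E`).
[cite: FultonHarris1991, Lecture 11 (§11.1)] [cite: MoonenZarhin1999LowDim, §2 (2.3)] -/
theorem eq_zero_of_combination_eq_zero [CharZero K] {P E F Z : Module.End K W} (hPP : P * P = P) (hPE : P * E = E)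
    (hEP : E * P = 0) (hPF : P * F = 0) (hFP : F * P = F) (hE0 : E ≠ 0) (hF0 : F ≠ 0)
    (hZP : Z * P = P * Z) (hZE : Z * E = E * Z) {c c' d : K}
    (h : c • E + c' • F + d • ((2 : K) • P - 1) + Z = 0) : c = 0 ∧ c' = 0 ∧ d = 0 ∧ Z = 0 := by
  have hEQ : E * (1 - P) = E := by rw [mul_sub, mul_one, hEP, sub_zero]
  have hQE : (1 - P) * E = 0 := by rw [sub_mul, one_mul, hPE, sub_self]
  have hQF : (1 - P) * F = F := by rw [sub_mul, one_mul, hPF, sub_zero]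
  have hΘ1 : ((2 : K) • P - 1) * (1 - P) = -(1 - P) := by
    rw [sub_mul, smul_mul_assoc, mul_sub, mul_one, hPP, sub_self, smul_zero, zero_sub, one_mul]
  have hΘb : P * ((2 : K) • P - 1) * (1 - P) = 0 := by
    rw [mul_assoc, hΘ1, mul_neg, mul_sub, mul_one, hPP, sub_self, neg_zero]
  have hΘ2 : ((2 : K) • P - 1) * P = P := by rw [sub_mul, smul_mul_assoc, hPP, one_mul, two_smul, add_sub_cancel_right]
  have hΘb' : (1 - P) * ((2 : K) • P - 1) * P = 0 := by rw [mul_assoc, hΘ2, sub_mul, one_mul, hPP, sub_self]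
  have hZb : P * Z * (1 - P) = 0 := by rw [mul_assoc, mul_sub, mul_one, hZP, mul_sub, ← mul_assoc, hPP, sub_self]
  have hZb' : (1 - P) * Z * P = 0 := by rw [mul_assoc, hZP, ← mul_assoc, sub_mul, one_mul, hPP, sub_self, zero_mul]
  -- corner `P · (1 − P)`: `c E = 0`
  have hc : c = 0 := by
    have h1 := congrArg (fun T => P * T * (1 - P)) h
    simp only [mul_add, add_mul, mul_smul_comm, smul_mul_assoc, mul_zero, zero_mul] at h1
    rw [hPE, hEQ, hPF, zero_mul, smul_zero, add_zero, hΘb, smul_zero, add_zero, hZb, add_zero] at h1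
    exact (smul_eq_zero.1 h1).resolve_right hE0
  -- corner `(1 − P) · P`: `c' F = 0`
  have hc' : c' = 0 := by
    have h1 := congrArg (fun T => (1 - P) * T * P) h
    simp only [mul_add, add_mul, mul_smul_comm, smul_mul_assoc, mul_zero, zero_mul] at h1
    rw [hQE, zero_mul, smul_zero, zero_add, hQF, hFP, hΘb', smul_zero, add_zero, hZb', add_zero] at h1
    exact (smul_eq_zero.1 h1).resolve_right hF0
  rw [hc, hc', zero_smul, zero_smul, zero_add, zero_add] at h
  -- bracket with `E`: `2 d E = 0`
  have hΘE : ((2 : K) • P - 1) * E - E * ((2 : K) • P - 1) = (2 : K) • E := by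
    rw [sub_mul, smul_mul_assoc, hPE, one_mul, mul_sub, mul_smul_comm, hEP, smul_zero, mul_one, zero_sub,
      sub_neg_eq_add, sub_add_cancel]
  have hd : d = 0 := by
    have h1 : (d • ((2 : K) • P - 1) + Z) * E - E * (d • ((2 : K) • P - 1) + Z) = 0 := by
      rw [h, zero_mul, mul_zero, sub_self]
    rw [add_mul, mul_add, smul_mul_assoc, mul_smul_comm, hZE, add_sub_add_right_eq_sub, ← smul_sub, hΘE, smul_smul] at h1
    have h3 : d * 2 = 0 := (smul_eq_zero.1 h1).resolve_right hE0
    exact (mul_eq_zero.1 h3).resolve_right two_ne_zero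
  rw [hd, zero_smul, zero_add] at h
  exact ⟨hc, hc', hd, h⟩

/-! ### The trace table -/

/-- `tr(z E K) = 0` for `K` commuting with `P`, `z` commuting with `P`, `E = P E (1 − P)`.
[cite: FultonHarris1991, Lecture 11 (§11.1)] -/
theorem trace_mul_projE_mul_eq_zero {P E z Z : Module.End K W} (hPP : P * P = P) (hPE : P * E = E)
    (hEP : E * P = 0) (hzP : z * P = P * z) (hZP : Z * P = P * Z) :
    LinearMap.trace K W (z * E * Z) = 0 := by
  have hEQ : E * (1 - P) = E := by rw [mul_sub, mul_one, hEP, sub_zero]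
  have hZQ : Z * (1 - P) = (1 - P) * Z := by rw [mul_sub, sub_mul, mul_one, one_mul, hZP]
  have hzP' : ∀ R : Module.End K W, z * (P * R) = P * (z * R) := fun R => by rw [← mul_assoc, hzP, mul_assoc]
  have step : z * E * Z = (z * P * E * Z) * (1 - P) := by
    conv_lhs => rw [← hEQ, ← hPE]
    simp only [mul_assoc]
    rw [hZQ]
  rw [step, LinearMap.trace_mul_comm, mul_assoc z P E, mul_assoc z (P * E) Z, mul_assoc P E Z, hzP', ← mul_assoc (1 - P) P,
    sub_mul, one_mul, hPP, sub_self, zero_mul, map_zero]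

/-- `tr(z F K) = 0` for `K` commuting with `P`, `z` commuting with `P`, `F = (1 − P) F P`.
[cite: FultonHarris1991, Lecture 11 (§11.1)] -/
theorem trace_mul_projF_mul_eq_zero {P F z Z : Module.End K W} (hPP : P * P = P) (hPF : P * F = 0)
    (hFP : F * P = F) (hzP : z * P = P * z) (hZP : Z * P = P * Z) :
    LinearMap.trace K W (z * F * Z) = 0 := by
  have hQF : (1 - P) * F = F := by rw [sub_mul, one_mul, hPF, sub_zero]
  have hzQ : z * (1 - P) = (1 - P) * z := by rw [mul_sub, sub_mul, mul_one, one_mul, hzP]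
  have hzQ' : ∀ R : Module.End K W, z * ((1 - P) * R) = (1 - P) * (z * R) := fun R => by
    rw [← mul_assoc, hzQ, mul_assoc]
  have step : z * F * Z = (z * (1 - P) * F * Z) * P := by
    conv_lhs => rw [← hFP, ← hQF]
    simp only [mul_assoc]
    rw [hZP]
  rw [step, LinearMap.trace_mul_comm, mul_assoc z (1 - P) F, mul_assoc z ((1 - P) * F) Z, mul_assoc (1 - P) F Z, hzQ',
    ← mul_assoc P (1 - P), mul_sub, mul_one, hPP, sub_self, zero_mul, map_zero]

/-- **`2 tr(z P K) = tr(z K)`** for `z` commuting with `E` and `K` commuting with `E` (`E F = αP`, `F E = α(1 − P)`):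
`tr(z E F K) = tr(z F E K)` by cyclicity. [cite: FultonHarris1991, Lecture 11 (§11.1)] [cite: MoonenZarhin1999LowDim, §2 (2.3)] -/
theorem two_mul_trace_mul_proj_mul {P E F z Z : Module.End K W} {α : K} (hα : α ≠ 0) (hEF : E * F = α • P)
    (hFE : F * E = α • (1 - P)) (hzE : z * E = E * z) (hZE : Z * E = E * Z) :
    2 * LinearMap.trace K W (z * P * Z) = LinearMap.trace K W (z * Z) := by
  have h1 : LinearMap.trace K W (z * E * F * Z) = LinearMap.trace K W (z * F * E * Z) := by
    calc LinearMap.trace K W (z * E * F * Z) = LinearMap.trace K W (E * (z * F * Z)) := by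
            rw [hzE, mul_assoc E z F, mul_assoc E]
      _ = LinearMap.trace K W (z * F * Z * E) := LinearMap.trace_mul_comm K _ _
      _ = LinearMap.trace K W (z * F * E * Z) := by rw [mul_assoc (z * F) Z E, hZE, ← mul_assoc]
  rw [mul_assoc z E F, hEF, mul_assoc z F E, hFE, mul_smul_comm, smul_mul_assoc, mul_smul_comm, smul_mul_assoc,
    map_smul, map_smul, smul_eq_mul, smul_eq_mul] at h1
  have h2 : LinearMap.trace K W (z * P * Z) = LinearMap.trace K W (z * (1 - P) * Z) := mul_left_cancel₀ hα h1
  have hsplit : z * Z = z * P * Z + z * (1 - P) * Z := by rw [mul_sub, sub_mul, mul_one]; abel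
  rw [hsplit, map_add, ← h2, two_mul]

/-- **`tr(z Θ K) = 0`** (`Θ = 2P − 1`), same hypotheses. [cite: MoonenZarhin1999LowDim, §2 (2.3)] -/
theorem trace_mul_theta_mul_eq_zero {P E F z Z : Module.End K W} {α : K} (hα : α ≠ 0) (hEF : E * F = α • P)
    (hFE : F * E = α • (1 - P)) (hzE : z * E = E * z) (hZE : Z * E = E * Z) :
    LinearMap.trace K W (z * ((2 : K) • P - 1) * Z) = 0 := by
  have h := two_mul_trace_mul_proj_mul hα hEF hFE hzE hZE
  rw [mul_sub, sub_mul, mul_smul_comm, smul_mul_assoc, mul_one, map_sub, map_smul, smul_eq_mul, h, sub_self]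

/-- **`2 tr(z P) = tr(z)`** and **`tr(z E F) = α tr(z P)`** for `z` commuting with `E`.
[cite: FultonHarris1991, Lecture 11 (§11.1)] -/
theorem two_mul_trace_mul_proj {P E F z : Module.End K W} {α : K} (hα : α ≠ 0) (hEF : E * F = α • P)
    (hFE : F * E = α • (1 - P)) (hzE : z * E = E * z) :
    2 * LinearMap.trace K W (z * P) = LinearMap.trace K W z ∧
      LinearMap.trace K W (z * E * F) = α * LinearMap.trace K W (z * P) := by
  have h := two_mul_trace_mul_proj_mul (Z := 1) hα hEF hFE hzE (by rw [one_mul, mul_one])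
  rw [mul_one, mul_one] at h
  refine ⟨h, ?_⟩
  rw [mul_assoc, hEF, mul_smul_comm, map_smul, smul_eq_mul]

end ProjectorBlocks

end Literature.AlgebraicGeometry.Motives

end
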